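import Literature.GroupTheory.CombinatorialGroupTheory.FiniteIndexAbelianizationFaithful
import Literature.GroupTheory.CombinatorialGroupTheory.SchreierIndexFormulaRank
import Literature.GroupTheory.CombinatorialGroupTheory.SurfaceGroupFiniteIndexSubgroupHolds
import Literature.GroupTheory.CombinatorialGroupTheory.PuncturedSurfaceGroupFree
import Literature.GroupTheory.CombinatorialGroupTheory.PuncturedSurfaceGroupFiniteIndexSubgroupHolds
import Literature.Topology.FourManifolds.SurfaceGroupAbelianisationKernels
import Literature.AnabelianGeometry.SemiGraphs.ProSigmaSurfaceCharacters
import Mathlib.Data.ZMod.Basic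
import HarnessLib

/-!
# Free groups, surface groups, `Γ_{g,r}`: the normaliser of a finite-index subgroup acts
# faithfully on its abelianisation; detection by characters to `ℤ/p^e`

Topic `Literature/GroupTheory/CombinatorialGroupTheory`; THEOREMS ONLY (no definition, no named fact).
Instances of the rank engine of `FiniteIndexAbelianizationFaithful.lean`
(`exists_conj_not_mem_commutator_of_rank_formula`: if `rank_ℤ K^{ab} = [Γ : K]·c + d`, `c ≥ 1`, for
all finite-index `K ≤ Γ`, then no `γ ∈ N_Γ(H) ∖ H` acts trivially on `H^{ab}`):

* `IsFreeGroup.exists_conj_not_mem_commutator` — `Γ` free of finite rank `n ≥ 2` (Schreier: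
  `rank K^{ab} = [Γ : K](n − 1) + 1`, Lyndon–Schupp I.3.9, tree `SchreierIndexFormulaRank`);
* `SurfaceGroup.exists_conj_not_mem_commutator` — `Γ = S_g`, `g ≥ 2` (`K ≅ S_h`,
  `h = [Γ : K](g − 1) + 1`, Zieschang–Vogt–Coldewey 4.14.23, tree
  `surfaceGroupFiniteIndexSubgroup_holds`; `S_h^{ab} = ℤ^{2h}`, Hurewicz, tree
  `SurfaceGroup.ker_abelianize`);
* `PuncturedSurfaceGroup.exists_conj_not_mem_commutator` — hyperbolic `Γ_{g,r}` (`r ≥ 1`: free of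
  rank `2g + r − 1`; `r = 0`: `≅ S_g`): **a nontrivial deck transformation of a finite unramified
  covering of hyperbolic surfaces moves a class of `H₁(·, ℤ)`**;
* `PuncturedSurfaceGroup.exists_linearEquiv_abelianization_of_finiteIndex` — the abelianisation of
  a finite-index subgroup of a hyperbolic `Γ_{g,r}` is free abelian of finite rank
  (Hoare–Karrass–Solitar / Riemann–Hurwitz structure theorem, tree
  `puncturedSurfaceGroupFiniteIndexSubgroup_holds`);
* `exists_character_zmod_primePow_ne_one`, `PuncturedSurfaceGroup.exists_character_conj_ne` — hence
  the moved class is detected by a character `H → ℤ/p^e` for ANY prime `p` (the form in which a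
  pro-`Σ` completion, `p ∈ Σ`, sees the deck action).

References: R. C. Lyndon, P. E. Schupp, *Combinatorial Group Theory*, Springer (2001), Ch. I
Prop. 3.9 [LyndonSchupp2001]; H. Zieschang, E. Vogt, H.-D. Coldewey, *Surfaces and Planar
Discontinuous Groups*, LNM 835 (1980), Thm 4.14.22 / Prop. 4.14.23 [ZieschangVogtColdewey1980];
A. Hatcher, *Algebraic Topology* (2002), §1.2 p. 51 [HatcherAT2002].
-/

noncomputable section

open scoped Classical

namespace Literature.GroupTheory.CombinatorialGroupTheory

open Literature.Topology.FourManifolds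

universe u


/-! ### Free groups of rank `≥ 2` -/

/-- **Free groups.**  In a free group `Γ` of finite rank `n ≥ 2`, for `H ≤ Γ` of finite index and
`γ ∈ N_Γ(H) ∖ H`, some `h ∈ H` has `γ h γ⁻¹ h⁻¹ ∉ [H, H]` (Schreier: `rank K^{ab} =
[Γ : K](n − 1) + 1`). [cite: LyndonSchupp2001, Ch. I Prop. 3.9] -/
theorem IsFreeGroup.exists_conj_not_mem_commutator {Γ : Type u} [Group Γ] [IsFreeGroup Γ]
    [Finite (IsFreeGroup.Generators Γ)] (hn : 2 ≤ Nat.card (IsFreeGroup.Generators Γ))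
    (H : Subgroup Γ) [H.FiniteIndex] (γ : Γ) (hγN : γ ∈ Subgroup.normalizer (H : Set Γ)) (hγH : γ ∉ H) :
    ∃ h ∈ H, γ * h * γ⁻¹ * h⁻¹ ∉ ⁅H, H⁆ := by
  refine exists_conj_not_mem_commutator_of_rank_formula
    (c := Nat.card (IsFreeGroup.Generators Γ) - 1) (d := 1) (by omega) ?_ H γ hγN hγH
  intro K hK
  haveI := hK
  obtain ⟨h1, h2⟩ := IsFreeGroup.finrank_abelianization_add_index K
  refine ⟨h2, ?_⟩
  have : K.index * Nat.card (IsFreeGroup.Generators Γ) =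
      K.index * (Nat.card (IsFreeGroup.Generators Γ) - 1) + K.index := by
    rw [Nat.mul_sub, mul_one, Nat.sub_add_cancel (Nat.le_mul_of_pos_right _ (by omega))]
  omega

/-! ### Closed surface groups `S_g`, `g ≥ 2` -/

/-- The abelianisation of `S_h` is `ℤ^{2h}` (Hurewicz: `ker (abelianize h) = [S_h, S_h]`, onto):
a multiplicative equivalence `S_h^{ab} ≃* ℤ^{surfaceGen h}`. [cite: HatcherAT2002, §1.2 p.51] -/
theorem SurfaceGroup.nonempty_abelianization_mulEquiv (h : ℕ) :
    Nonempty (Abelianization (SurfaceGroup h) ≃* Multiplicative (surfaceGen h → ℤ)) := by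
  have hker := SurfaceGroup.ker_abelianize h
  refine ⟨(QuotientGroup.quotientMulEquivOfEq ?_).trans
    (QuotientGroup.quotientKerEquivOfSurjective _ (SurfaceGroup.abelianize_surjective h))⟩
  exact hker.symm

/-- Hence `rank_ℤ S_h^{ab} = 2h` and `S_h^{ab}` is a finite `ℤ`-module.
[cite: HatcherAT2002, §1.2 p.51] -/
theorem SurfaceGroup.finrank_abelianization (h : ℕ) :
    Module.Finite ℤ (Additive (Abelianization (SurfaceGroup h))) ∧
      Module.finrank ℤ (Additive (Abelianization (SurfaceGroup h))) = 2 * h := by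
  obtain ⟨e⟩ := SurfaceGroup.nonempty_abelianization_mulEquiv h
  let L : Additive (Abelianization (SurfaceGroup h)) ≃ₗ[ℤ] (surfaceGen h → ℤ) :=
    (MulEquiv.toAdditive e).toIntLinearEquiv
  refine ⟨Module.Finite.equiv L.symm, ?_⟩
  rw [L.finrank_eq, Module.finrank_fintype_fun_eq_card]
  simp [surfaceGen, Fintype.card_prod, Fintype.card_bool, mul_comm]

/-- The rank formula for closed surface groups: a finite-index `K ≤ S_g` (`g ≥ 2`) has
`rank_ℤ K^{ab} = [S_g : K]·(2g − 2) + 2` (`K ≅ S_h`, `h = [S_g : K](g − 1) + 1`, F_cov).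
[cite: ZieschangVogtColdewey1980, Prop 4.14.23 p.154] -/
theorem SurfaceGroup.rank_formula {g : ℕ} (hg : 2 ≤ g) :
    ∀ K : Subgroup (SurfaceGroup g), K.FiniteIndex →
      Module.Finite ℤ (Additive (Abelianization K)) ∧
        Module.finrank ℤ (Additive (Abelianization K)) = K.index * (2 * g - 2) + 2 := by
  intro K hK
  obtain ⟨h, hh, ⟨ψ⟩⟩ := surfaceGroupFiniteIndexSubgroup_holds g hg K hK
  obtain ⟨hfin, hrk⟩ := SurfaceGroup.finrank_abelianization h
  let L : Additive (Abelianization K) ≃ₗ[ℤ] Additive (Abelianization (SurfaceGroup h)) :=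
    (MulEquiv.toAdditive ψ.abelianizationCongr).toIntLinearEquiv
  haveI := hfin
  refine ⟨Module.Finite.equiv L.symm, ?_⟩
  rw [L.finrank_eq, hrk, hh]
  have : 2 * g - 2 = 2 * (g - 1) := by omega
  rw [this]
  ring

/-- **Closed surface groups.**  In `S_g`, `g ≥ 2`, for `H` of finite index and
`γ ∈ N(H) ∖ H`, some `h ∈ H` has `γ h γ⁻¹ h⁻¹ ∉ [H, H]`.
[cite: ZieschangVogtColdewey1980, Prop 4.14.23 p.154] -/
theorem SurfaceGroup.exists_conj_not_mem_commutator {g : ℕ} (hg : 2 ≤ g)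
    (H : Subgroup (SurfaceGroup g)) [H.FiniteIndex] (γ : SurfaceGroup g)
    (hγN : γ ∈ Subgroup.normalizer (H : Set (SurfaceGroup g))) (hγH : γ ∉ H) :
    ∃ h ∈ H, γ * h * γ⁻¹ * h⁻¹ ∉ ⁅H, H⁆ :=
  exists_conj_not_mem_commutator_of_rank_formula (c := 2 * g - 2) (d := 2) (by omega)
    (SurfaceGroup.rank_formula hg) H γ hγN hγH

/-! ### Hyperbolic punctured surface groups `Γ_{g,r}` -/

namespace PuncturedSurfaceGroup

variable {g r : ℕ}

/-- The rank formula for hyperbolic `Γ_{g,r}`: some `c ≥ 1` and `d` with `rank_ℤ K^{ab} =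
[Γ : K]·c + d` for every finite-index `K` (`r ≥ 1`: free of rank `2g + r − 1 ≥ 2`, Schreier;
`r = 0`: `Γ_{g,0} ≅ S_g`, F_cov). [cite: LyndonSchupp2001, Ch. I Prop. 3.9]
[cite: ZieschangVogtColdewey1980, Prop 4.14.23 p.154] -/
theorem exists_rank_formula (hgr : IsHyperbolicType g r) :
    ∃ c d : ℕ, 1 ≤ c ∧ ∀ K : Subgroup (PuncturedSurfaceGroup g r), K.FiniteIndex →
      Module.Finite ℤ (Additive (Abelianization K)) ∧
        Module.finrank ℤ (Additive (Abelianization K)) = K.index * c + d := by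
  rcases Nat.eq_zero_or_pos r with hr | hr
  · subst hr
    have hg : 2 ≤ g := by unfold IsHyperbolicType at hgr; omega
    obtain ⟨e⟩ := Literature.AnabelianGeometry.SemiGraphs.SemiGraphOfAnabelioids.IsProSigmaCompletion.nonempty_mulEquiv_puncturedSurfaceGroup_zero g
    exact ⟨2 * g - 2, 2, by omega, rank_formula_of_mulEquiv e (SurfaceGroup.rank_formula hg)⟩
  · obtain ⟨k, rfl⟩ : ∃ k, r = k + 1 := ⟨r - 1, by omega⟩
    obtain ⟨e⟩ := nonempty_mulEquiv_freeGroup (g := g) (r := k)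
    let α := (Fin g × Bool) ⊕ Fin k
    let eg : α ≃ IsFreeGroup.Generators (FreeGroup α) :=
      Equiv.ofFreeGroupEquiv (IsFreeGroup.toFreeGroup (FreeGroup α))
    haveI : Finite (IsFreeGroup.Generators (FreeGroup α)) := Finite.of_equiv α eg
    have hcard : Nat.card (IsFreeGroup.Generators (FreeGroup α)) = 2 * g + k := by
      rw [← Nat.card_congr eg]
      simp [α, mul_comm]
    have hn : 2 ≤ Nat.card (IsFreeGroup.Generators (FreeGroup α)) := by
      rw [hcard]; unfold IsHyperbolicType at hgr; omega
    refine ⟨2 * g + k - 1, 1, by omega, rank_formula_of_mulEquiv e ?_⟩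
    intro K hK
    haveI := hK
    obtain ⟨h1, h2⟩ := IsFreeGroup.finrank_abelianization_add_index K
    refine ⟨h2, ?_⟩
    rw [hcard] at h1
    have : K.index * (2 * g + k) = K.index * (2 * g + k - 1) + K.index := by
      rw [Nat.mul_sub, mul_one, Nat.sub_add_cancel (Nat.le_mul_of_pos_right _ (by omega))]
    omega

/-- **Hyperbolic `Γ_{g,r}`.**  For `H ≤ Γ_{g,r}` of finite index (`2g − 2 + r > 0`) and
`γ ∈ N(H) ∖ H`, some `h ∈ H` has `γ h γ⁻¹ h⁻¹ ∉ [H, H]`: a nontrivial deck transformation of a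
finite unramified covering of hyperbolic surfaces moves a class of `H₁(·, ℤ)`.
[cite: LyndonSchupp2001, Ch. I Prop. 3.9] [cite: ZieschangVogtColdewey1980, Prop 4.14.23 p.154] -/
theorem exists_conj_not_mem_commutator (hgr : IsHyperbolicType g r)
    (H : Subgroup (PuncturedSurfaceGroup g r)) [H.FiniteIndex] (γ : PuncturedSurfaceGroup g r)
    (hγN : γ ∈ Subgroup.normalizer (H : Set (PuncturedSurfaceGroup g r))) (hγH : γ ∉ H) :
    ∃ h ∈ H, γ * h * γ⁻¹ * h⁻¹ ∉ ⁅H, H⁆ := by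
  obtain ⟨c, d, hc, hrank⟩ := exists_rank_formula hgr
  exact exists_conj_not_mem_commutator_of_rank_formula hc hrank H γ hγN hγH

/-- The abelianisation of a finite-index subgroup `H` of a hyperbolic `Γ_{g,r}` is FREE abelian of
finite rank (`H ≅ Γ_{g',r'}` by the Hoare–Karrass–Solitar / Riemann–Hurwitz structure theorem;
`Γ_{g',r'+1}` free, `Γ_{g',0} ≅ S_{g'}` with `S_{g'}^{ab} = ℤ^{2g'}`).
[cite: ZieschangVogtColdewey1980, Thm 4.14.22 / Prop 4.14.23 p.154] -/
theorem exists_linearEquiv_abelianization_of_finiteIndex (hgr : IsHyperbolicType g r)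
    (H : Subgroup (PuncturedSurfaceGroup g r)) [H.FiniteIndex] :
    ∃ n : ℕ, Nonempty (Additive (Abelianization H) ≃ₗ[ℤ] (Fin n → ℤ)) := by
  obtain ⟨g', r', θ, -, -, -, hθ, hrange, -⟩ := puncturedSurfaceGroupFiniteIndexSubgroup_holds g r hgr H inferInstance
  -- `H ≃* Γ_{g',r'}`
  let ψ : PuncturedSurfaceGroup g' r' ≃* H :=
    (MonoidHom.ofInjective hθ).trans (MulEquiv.subgroupCongr hrange)
  rcases Nat.eq_zero_or_pos r' with hr' | hr'
  · subst hr'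
    obtain ⟨e⟩ := Literature.AnabelianGeometry.SemiGraphs.SemiGraphOfAnabelioids.IsProSigmaCompletion.nonempty_mulEquiv_puncturedSurfaceGroup_zero g'
    obtain ⟨a⟩ := SurfaceGroup.nonempty_abelianization_mulEquiv g'
    let L : Additive (Abelianization H) ≃ₗ[ℤ] (surfaceGen g' → ℤ) :=
      (MulEquiv.toAdditive ((ψ.symm.trans e).abelianizationCongr.trans a)).toIntLinearEquiv
    let F : (surfaceGen g' → ℤ) ≃ₗ[ℤ] (Fin (Fintype.card (surfaceGen g')) → ℤ) :=
      LinearEquiv.funCongrLeft ℤ ℤ (Fintype.equivFin (surfaceGen g')).symm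
    exact ⟨_, ⟨L.trans F⟩⟩
  · obtain ⟨k, rfl⟩ : ∃ k, r' = k + 1 := ⟨r' - 1, by omega⟩
    obtain ⟨e⟩ := nonempty_mulEquiv_freeGroup (g := g') (r := k)
    let b : FreeGroupBasis ((Fin g' × Bool) ⊕ Fin k) H := FreeGroupBasis.ofRepr (ψ.symm.trans e)
    obtain ⟨L⟩ := nonempty_additive_abelianization_linearEquiv_fun b
    let F : (((Fin g' × Bool) ⊕ Fin k) → ℤ) ≃ₗ[ℤ]
        (Fin (Fintype.card ((Fin g' × Bool) ⊕ Fin k)) → ℤ) :=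
      LinearEquiv.funCongrLeft ℤ ℤ (Fintype.equivFin _).symm
    exact ⟨_, ⟨L.trans F⟩⟩

end PuncturedSurfaceGroup

/-! ### Detecting classes by characters to `ℤ/p^e` -/

/-- In a group `H` whose abelianisation is free abelian of finite rank, a class outside `[H, H]`
is detected by a character `H → ℤ/p^e`, for ANY prime `p` and a suitable `e ≥ 1`.
[cite: LyndonSchupp2001, Ch. I Prop. 3.9] -/
theorem exists_character_zmod_primePow_ne_one {H : Type u} [Group H] {n : ℕ}
    (L : Additive (Abelianization H) ≃ₗ[ℤ] (Fin n → ℤ)) (w : H) (hw : w ∉ commutator H)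
    (p : ℕ) (hp : p.Prime) :
    ∃ (e : ℕ) (χ : H →* Multiplicative (ZMod (p ^ e))), 0 < e ∧ χ w ≠ 1 := by
  -- the vector of `w` is nonzero, pick a nonzero coordinate
  set v : Fin n → ℤ := L (Additive.ofMul (Abelianization.of w)) with hv
  have hv0 : v ≠ 0 := by
    intro h0
    apply hw
    rw [← Abelianization.ker_of, MonoidHom.mem_ker]
    have : Additive.ofMul (Abelianization.of w) = 0 := by
      apply L.injective
      rw [← hv, h0, map_zero]
    exact this
  obtain ⟨i, hi⟩ : ∃ i, v i ≠ 0 := by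
    by_contra h
    simp only [not_exists, not_not] at h
    exact hv0 (funext h)
  set e : ℕ := (v i).natAbs with he
  have he0 : 0 < e := Int.natAbs_pos.mpr hi
  -- `p^e > |v i|`, so `v i ≠ 0` in `ℤ/p^e`
  have hlt : (v i).natAbs < p ^ e :=
    lt_of_lt_of_le (Nat.lt_two_pow_self) (Nat.pow_le_pow_left hp.two_le e)
  have hne : ((v i : ℤ) : ZMod (p ^ e)) ≠ 0 := by
    rw [Ne, ZMod.intCast_zmod_eq_zero_iff_dvd]
    rintro ⟨c, hc⟩
    have hc0 : c ≠ 0 := by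
      rintro rfl
      rw [mul_zero] at hc
      exact hi hc
    have h1 : (v i).natAbs = p ^ e * c.natAbs := by
      rw [hc, Int.natAbs_mul, Int.natAbs_natCast]
    have h2 : 1 ≤ c.natAbs := Int.natAbs_pos.mpr hc0
    have h3 : p ^ e ≤ (v i).natAbs := by
      rw [h1]
      exact Nat.le_mul_of_pos_right _ h2
    exact absurd h3 (not_le.mpr hlt)
  -- the character: `w ↦ (i-th coordinate of its class) mod p^e`
  let χ₀ : Additive (Abelianization H) →+ ZMod (p ^ e) :=
    ((Int.castAddHom (ZMod (p ^ e))).comp (LinearMap.proj i : (Fin n → ℤ) →ₗ[ℤ] ℤ).toAddMonoidHom).comp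
      L.toLinearMap.toAddMonoidHom
  let χ : H →* Multiplicative (ZMod (p ^ e)) :=
    (AddMonoidHom.toMultiplicativeRight χ₀).comp Abelianization.of
  refine ⟨e, χ, he0, ?_⟩
  intro h1
  apply hne
  have h2 : χ₀ (Additive.ofMul (Abelianization.of w)) = 0 := by
    have h3 := congrArg Multiplicative.toAdd h1
    exact h3
  exact h2

namespace PuncturedSurfaceGroup

variable {g r : ℕ}

/-- **Characters see the deck action.**  For `H ≤ Γ_{g,r}` of finite index (hyperbolic type),
`γ ∈ N(H) ∖ H` and any prime `p`: there are `e ≥ 1`, a character `χ : H → ℤ/p^e` and `h ∈ H` with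
`χ(γ h γ⁻¹) ≠ χ(h)` — the form used by pro-`Σ` completions (`p ∈ Σ`).
[cite: LyndonSchupp2001, Ch. I Prop. 3.9] [cite: ZieschangVogtColdewey1980, Prop 4.14.23 p.154] -/
theorem exists_character_conj_ne (hgr : IsHyperbolicType g r)
    (H : Subgroup (PuncturedSurfaceGroup g r)) [H.FiniteIndex] (γ : PuncturedSurfaceGroup g r)
    (hγN : γ ∈ Subgroup.normalizer (H : Set (PuncturedSurfaceGroup g r))) (hγH : γ ∉ H)
    (p : ℕ) (hp : p.Prime) :
    ∃ (e : ℕ) (χ : H →* Multiplicative (ZMod (p ^ e))) (h : H), 0 < e ∧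
      χ ⟨γ * h * γ⁻¹, (Subgroup.mem_normalizer_iff.mp hγN (h : PuncturedSurfaceGroup g r)).mp h.2⟩ ≠
        χ h := by
  obtain ⟨h, hh, hw⟩ := exists_conj_not_mem_commutator hgr H γ hγN hγH
  obtain ⟨n, ⟨L⟩⟩ := exists_linearEquiv_abelianization_of_finiteIndex hgr H
  have hγh : γ * h * γ⁻¹ ∈ H := (Subgroup.mem_normalizer_iff.mp hγN h).mp hh
  set w : H := ⟨γ * h * γ⁻¹, hγh⟩ * ⟨h, hh⟩⁻¹ with hwdef
  have hw' : w ∉ commutator H := by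
    rw [mem_commutator_iff_coe_mem]
    exact hw
  obtain ⟨e, χ, he, hχ⟩ := exists_character_zmod_primePow_ne_one L w hw' p hp
  refine ⟨e, χ, ⟨h, hh⟩, he, fun heq => hχ ?_⟩
  rw [hwdef, map_mul, map_inv, heq, mul_inv_cancel]

end PuncturedSurfaceGroup

end Literature.GroupTheory.CombinatorialGroupTheory

end
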